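import Literature.Analysis.FluidPDE.PassiveVectorLionsExistence
import Literature.Analysis.FluidPDE.PassiveVectorTensor
import Literature.Analysis.FluidPDE.PassiveVectorSuperposition
import Literature.Analysis.FluidPDE.LagrangianLatticeCarrier
import Summits.AnomalousDissipation.AnomalousDissipation.Theorems.SolenoidalFractalHomogenisationRealisedQuasiStaticCellLawSectorReduction
import Summits.AnomalousDissipation.AnomalousDissipation.Theorems.SolenoidalFractalHomogenisationRealisedQuasiStaticCellLawCellUnique
import HarnessLib

/-!
# K1L `LagrangianRenormalisationStep` (stmt-AnomalousDissipation-24912), registered line `birth` (v9):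
the content of the registered stub `stub_existsL` modulo per-level regularity of the Lagrangian carrier

Helper file for the crux `LagrangianRenormalisationStep` of route `SolenoidalFractalHomogenisation` (cell `ad-ideate`;
registered skeleton `HOME/ad-ideate-p1/r17/LagrangianRenormalisationStep_birth_v9_lit_tree.lean`, sha16 `44fd45a3f04a315f`).

`stub_existsL` asks, for an `LPermissible`, `Regular` Lagrangian lattice carrier `E`, every level `m` and every admissible datum
`w₀` (`H¹`, mean zero, weakly divergence free), for SOME weak solution in the tensor class
`Torus.IsWeakTensorPassiveVectorOn 0 1 (Torus.isoVisc (E.kbar m)) (E.partialSum m) w₀ ·` of the truncated problem along the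
partial sum `b 1 + ⋯ + b m`.  J.-L. Lions' theorem (`Torus.exists_isWeakPassiveVectorOn`, landed) + the bridge
`IsWeakPassiveVectorOn.toTensor` give it as soon as the CARRIER `E.partialSum m` is essentially bounded and jointly measurable on
`(0,1) × 𝕋³` and weakly divergence free for a.e. `t` — facts which `E.Regular` states only for the FULL carrier `∑' b (m+1)`, and
which `E.LPermissible` pins only implicitly (through the flow/insertion equations).  This file therefore proves

* the generic existence statement for a jointly continuous carrier with divergence-free slices
  (`exists_isWeakTensorPassiveVectorOn_isoVisc_of_continuous`, with `memLp_top_stLift_of_continuous`);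
* the level-to-partial-sum bookkeeping (`continuous_uncurry_partialSum`, `isWeaklyDivFree_partialSum`) and the stub MODULO
  per-level continuity and divergence-freeness of the levels below `m` (`existsL_of_levels`) — the two clauses finding
  F-g5-1 (cell STATUS 2026-08-28T06:15Z) proposes to add to the interface on the construction side;
* unconditionally, the levels `m ≤ 1`: under `IsLagrangian` the first level IS the Eulerian lattice level
  (`b_one_eq_level_one`: `disp 0 = 0`, `X 0 = id`, `flowDeriv 0 = id`), so `partialSum 0 = 0` and `partialSum 1 = level 1` are
  jointly continuous and divergence free, and `stub_existsL` holds for `m ≤ 1` from `LPermissible` alone (`existsL_of_le_one`).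

No definitions, no named facts, no sorry.  Prover seat `ad-solenoidal-k2r-lowerlaw-p1` g5 (2026-08-28), `--supports stmt-AnomalousDissipation-24912`.
-/

set_option linter.dupNamespace false

noncomputable section

namespace Summit.AnomalousDissipation.AnomalousDissipation.Theorems.SolenoidalFractalHomogenisation.LagrangianRenormalisationStep

open Set Filter Topology MeasureTheory Function
open scoped InnerProductSpace ENNReal NNReal
open Literature.Analysis Literature.Analysis.FunctionSpaces Literature.Analysis.FunctionSpaces.Torus
open Literature.Analysis.FluidPDE Literature.Analysis.FluidPDE.LatticeShear
open Summit.AnomalousDissipation.AnomalousDissipation.Theorems.SolenoidalFractalHomogenisation.RealisedQuasiStaticCellLaw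
  (continuous_uncurry_cell memLp_two_of_memSobolev_one_complexify)

variable {k : ℕ}

/-! ## Generic: continuous carriers with divergence-free slices -/

/-- A jointly continuous carrier on `ℝ × 𝕋³` has an essentially bounded space–time lift on every slab `(0,T) × 𝕋³`
(continuity on the compact `[0,T] × 𝕋³`). [folklore] -/
theorem memLp_top_stLift_of_continuous {b : ℝ → UnitAddTorus (Fin 3) → EuclideanSpace ℝ (Fin 3)}
    (hb : Continuous (uncurry b)) (T : ℝ) :
    MemLp (stLift b) ∞ (volume.restrict (Ioo 0 T ×ˢ (univ : Set (EuclideanSpace ℝ (Fin 3))))) := by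
  have hc : Continuous (stLift b) := by
    have e : stLift b = uncurry b ∘ Prod.map id proj := by
      funext ⟨t, y⟩
      rfl
    rw [e]
    exact hb.comp (continuous_id.prodMap continuous_proj)
  -- a bound on the compact set `[0,T] × 𝕋³`
  obtain ⟨C, hC⟩ := (isCompact_Icc.prod isCompact_univ :
      IsCompact (Icc (0:ℝ) T ×ˢ (univ : Set (UnitAddTorus (Fin 3))))).exists_bound_of_continuousOn hb.continuousOn
  refine memLp_top_of_bound hc.aestronglyMeasurable C ?_
  rw [ae_restrict_iff' (measurableSet_Ioo.prod MeasurableSet.univ)]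
  refine ae_of_all _ fun p hp => ?_
  have ht : p.1 ∈ Icc (0:ℝ) T := Ioo_subset_Icc_self hp.1
  have h := hC (p.1, proj p.2) ⟨ht, mem_univ _⟩
  obtain ⟨t, y⟩ := p
  exact h

/-- **Existence in the tensor class at an isotropic tensor, along a continuous carrier** (J.-L. Lions' theorem
`Torus.exists_isWeakPassiveVectorOn` + the bridge `IsWeakPassiveVectorOn.toTensor`): for `T > 0`, `ν > 0`, a jointly continuous
carrier `b` whose slices are weakly divergence free, and an `L²` weakly divergence-free datum, the problem
`∂ₜu + (b·∇)u + ∇π = νΔu`, `∇·u = 0`, `u(0) = w₀` has a weak solution in `IsWeakTensorPassiveVectorOn 0 T (isoVisc ν) b w₀`.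
[cite: LionsMagenes1972, Chap. 3 Thm. 1.1] -/
theorem exists_isWeakTensorPassiveVectorOn_isoVisc_of_continuous
    {b : ℝ → UnitAddTorus (Fin 3) → EuclideanSpace ℝ (Fin 3)} (hb : Continuous (uncurry b))
    (hbdiv : ∀ t, IsWeaklyDivFree (b t)) {T ν : ℝ} (hT : 0 < T) (hν : 0 < ν)
    {w₀ : UnitAddTorus (Fin 3) → EuclideanSpace ℝ (Fin 3)} (hw₀ : MemLp w₀ 2 volume) (hdiv₀ : IsWeaklyDivFree w₀) :
    ∃ u, Torus.IsWeakTensorPassiveVectorOn 0 T (Torus.isoVisc ν) b w₀ u := by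
  obtain ⟨u, hu⟩ := Torus.exists_isWeakPassiveVectorOn hT hν (memLp_top_stLift_of_continuous hb T)
    (ae_of_all _ fun t => hbdiv t) hw₀ hdiv₀
  exact ⟨u, hu.toTensor⟩

/-! ## Levels → partial sums -/

/-- The partial sum `b 1 + ⋯ + b m` is jointly continuous if its levels are. [folklore] -/
theorem continuous_uncurry_partialSum (E : LagrangianLatticeCarrier k) (m : ℕ)
    (hc : ∀ i < m, Continuous (uncurry (E.b (i + 1)))) : Continuous (uncurry (E.partialSum m)) := by
  have e : uncurry (E.partialSum m) = fun p : ℝ × UnitAddTorus (Fin 3) => ∑ i ∈ Finset.range m, uncurry (E.b (i + 1)) p := by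
    funext ⟨t, x⟩
    simp [LagrangianLatticeCarrier.partialSum]
  rw [e]
  exact continuous_finsetSum _ fun i hi => hc i (Finset.mem_range.mp hi)

/-- The partial sum `b 1 + ⋯ + b m` is weakly divergence free at every time if its levels are continuous and weakly
divergence free (Temam's space `H` is linear). [cite: Temam1984, Ch. I §1.4 (the space H)] -/
theorem isWeaklyDivFree_partialSum (E : LagrangianLatticeCarrier k) (m : ℕ)
    (hc : ∀ i < m, Continuous (uncurry (E.b (i + 1)))) (hd : ∀ i < m, ∀ t, IsWeaklyDivFree (E.b (i + 1) t)) (t : ℝ) :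
    IsWeaklyDivFree (E.partialSum m t) := by
  induction m with
  | zero =>
    intro θ _
    simp [LagrangianLatticeCarrier.partialSum]
  | succ m ih =>
    have hc' : ∀ i < m, Continuous (uncurry (E.b (i + 1))) := fun i hi => hc i (Nat.lt_succ_of_lt hi)
    have hd' : ∀ i < m, ∀ t, IsWeaklyDivFree (E.b (i + 1) t) := fun i hi => hd i (Nat.lt_succ_of_lt hi)
    have hm := ih hc' hd'
    have e : E.partialSum (m + 1) t = fun x => E.partialSum m t x + E.b (m + 1) t x := by
      funext x
      simp [LagrangianLatticeCarrier.partialSum, Finset.sum_range_succ]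
    rw [e]
    have hcont_m : Continuous (E.partialSum m t) :=
      (continuous_uncurry_partialSum E m hc').comp (Continuous.prodMk_right t)
    have hcont_b : Continuous (E.b (m + 1) t) := (hc m (Nat.lt_succ_self m)).comp (Continuous.prodMk_right t)
    exact hm.add_of_integrable (hd m (Nat.lt_succ_self m) t) hcont_m.integrable_unitAddTorus
      hcont_b.integrable_unitAddTorus

/-- **`stub_existsL` modulo per-level regularity.**  If the levels `b 1, …, b m` of a Lagrangian lattice carrier are jointly
continuous and weakly divergence free at every time, then every admissible datum (`H¹`, mean zero, weakly divergence free —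
the skeleton's `IsDatum`, unfolded) admits a weak solution of the level-`m` truncated problem in the tensor class at the
isotropic tensor `isoVisc (kbar m)` (the skeleton's `TSol E m (isoVisc (E.kbar m)) w₀ u`, unfolded). [cite: LionsMagenes1972, Chap. 3 Thm. 1.1] -/
theorem existsL_of_levels (E : LagrangianLatticeCarrier k) (m : ℕ)
    (hc : ∀ i < m, Continuous (uncurry (E.b (i + 1)))) (hd : ∀ i < m, ∀ t, IsWeaklyDivFree (E.b (i + 1) t))
    (w₀ : UnitAddTorus (Fin 3) → EuclideanSpace ℝ (Fin 3))
    (hw₀ : MemSobolev 1 (FunctionSpaces.EuclideanSpace.complexify ∘ w₀) ∧ HasZeroMean w₀ ∧ IsWeaklyDivFree w₀) :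
    ∃ u, Torus.IsWeakTensorPassiveVectorOn 0 1 (Torus.isoVisc (E.kbar m)) (E.partialSum m) w₀ u :=
  exists_isWeakTensorPassiveVectorOn_isoVisc_of_continuous (continuous_uncurry_partialSum E m hc)
    (isWeaklyDivFree_partialSum E m hc hd) one_pos (E.kbar_pos m) (memLp_two_of_memSobolev_one_complexify hw₀.1) hw₀.2.2

/-! ## Unconditional: the first level is Eulerian -/

/-- An Eulerian lattice level `(t, x) ↦ a_m • (word m).cell (N m) (a_m t) x` is jointly continuous. [folklore] -/
theorem continuous_uncurry_level (D : FractalCarrierData k) (m : ℕ) : Continuous (uncurry (D.level m)) := by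
  have e : uncurry (D.level m) = fun p : ℝ × UnitAddTorus (Fin 3) =>
      D.a m • uncurry ((D.word m).cell (D.N m)) (D.a m * p.1, p.2) := by
    funext ⟨t, x⟩
    rfl
  rw [e]
  exact ((continuous_uncurry_cell (D.word m) (D.N m)).comp
    ((continuous_const.mul continuous_fst).prodMk continuous_snd)).const_smul (D.a m)

/-- Below level `1` the flow is the identity, so its derivative is the identity: `flowDeriv 0 = id` under `IsFlow 0`.
[cite: ArmstrongVicol2025, §2.2 (PDF p. 18: X_m(s,x,s) = x, b_0 = 0)] -/
theorem flowDeriv_zero_of_isFlow (E : LagrangianLatticeCarrier k) (h : E.IsFlow 0) (t s : ℝ) (x : UnitAddTorus (Fin 3)) :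
    E.flowDeriv 0 t s x = ContinuousLinearMap.id ℝ (EuclideanSpace ℝ (Fin 3)) := by
  have e : Torus.lift (E.disp 0 t s) = fun _ => (0 : EuclideanSpace ℝ (Fin 3)) := by
    funext y
    rw [Torus.lift_apply, E.disp_zero_of_isFlow h]
  rw [LagrangianLatticeCarrier.flowDeriv, e]
  simp

/-- **Under `IsLagrangian` the first level IS the Eulerian lattice level**: `b 1 = level 1` (the window-wise insertion
`b 1 t (X 0 t w y) = flowDeriv 0 t w y (level 1 t y)` with `X 0 = id`, `flowDeriv 0 = id`; every time lies in some refresh window).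
[cite: ArmstrongVicol2025, §2.2 (PDF p. 18: b_1 = v_1, the iterative construction)] -/
theorem b_one_eq_level_one (E : LagrangianLatticeCarrier k) (hL : E.IsLagrangian) :
    E.b 1 = E.toFractalCarrierData.level 1 := by
  obtain ⟨hF, hI⟩ := hL 0
  funext t y
  -- the refresh window of level `1` containing `t`
  set R : ℝ := E.refresh (0 + 1) with hR
  have hRpos : 0 < R := E.refresh_pos _
  set j : ℤ := ⌊t / R⌋ with hj
  have ht : t ∈ E.window (0 + 1) j := by
    refine ⟨?_, ?_⟩
    · have h1 : (j : ℝ) ≤ t / R := Int.floor_le _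
      calc (j : ℝ) * E.refresh (0 + 1) = (j : ℝ) * R := rfl
        _ ≤ t / R * R := mul_le_mul_of_nonneg_right h1 hRpos.le
        _ = t := div_mul_cancel₀ t hRpos.ne'
    · have h2 : t / R < (j : ℝ) + 1 := Int.lt_floor_add_one _
      calc t = t / R * R := (div_mul_cancel₀ t hRpos.ne').symm
        _ < ((j : ℝ) + 1) * R := mul_lt_mul_of_pos_right h2 hRpos
  have key := hI j t ht y
  rw [E.X_zero_of_isFlow hF, flowDeriv_zero_of_isFlow E hF] at key
  simpa using key

/-- `partialSum 1 = level 1` under `IsLagrangian`. [cite: ArmstrongVicol2025, §2.2 (PDF p. 18: b_1 = v_1)] -/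
theorem partialSum_one_eq_level_one (E : LagrangianLatticeCarrier k) (hL : E.IsLagrangian) :
    E.partialSum 1 = E.toFractalCarrierData.level 1 := by
  funext t x
  simp [LagrangianLatticeCarrier.partialSum, b_one_eq_level_one E hL]

/-- **`stub_existsL` for the levels `m ≤ 1`, from `LPermissible` alone**: `partialSum 0 = 0` and `partialSum 1 = level 1` are
jointly continuous with divergence-free slices, so Lions' theorem applies. [cite: LionsMagenes1972, Chap. 3 Thm. 1.1] -/
theorem existsL_of_le_one (E : LagrangianLatticeCarrier k) (hP : E.LPermissible) (m : ℕ) (hm : m ≤ 1)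
    (w₀ : UnitAddTorus (Fin 3) → EuclideanSpace ℝ (Fin 3))
    (hw₀ : MemSobolev 1 (FunctionSpaces.EuclideanSpace.complexify ∘ w₀) ∧ HasZeroMean w₀ ∧ IsWeaklyDivFree w₀) :
    ∃ u, Torus.IsWeakTensorPassiveVectorOn 0 1 (Torus.isoVisc (E.kbar m)) (E.partialSum m) w₀ u := by
  have hb1 : E.b 1 = E.toFractalCarrierData.level 1 := b_one_eq_level_one E hP.isLagrangian
  refine existsL_of_levels E m (fun i hi => ?_) (fun i hi t => ?_) w₀ hw₀
  · obtain rfl : i = 0 := by omega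
    simpa [hb1] using continuous_uncurry_level E.toFractalCarrierData 1
  · obtain rfl : i = 0 := by omega
    simpa [hb1] using
      Summit.AnomalousDissipation.AnomalousDissipation.Theorems.SolenoidalFractalHomogenisation.PermissibleCarrier.isWeaklyDivFree_level
        E.toFractalCarrierData 1 t

end Summit.AnomalousDissipation.AnomalousDissipation.Theorems.SolenoidalFractalHomogenisation.LagrangianRenormalisationStep

end
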